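import Literature.IUT.HodgeTheaters.PuncturedEllipticCoveringsCor12OfOriginLawsModLFields
import Literature.IUT.HodgeTheaters.PuncturedEllipticCoveringsCor12HextOfCor33i
import Literature.IUT.HodgeTheaters.PuncturedEllipticGeomOrigin
import HarnessLib

/-!
# [IUTchI] Cor. 1.2 at the genuine `K`-level data — the GRAND KNIT of tonight's three lanes: origin records (R6),
# the `ModLCuspLaws` split (R23) and the [AbsTopII] Cor. 3.3 (i) adapter (R7): LAW = the eight printed `Δ_ε`-sentences only

Mochizuki, *Inter-universal Teichmüller theory I*, kurims manuscript (May 2020), §1 pp. 37–39, Corollary 1.2 and its proof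
p. 39 l. 19–46 [cite: Mochizuki2012, IUTchI Cor 1.2 p.39] (D-0012 claim key; series status DISPUTED — nothing of the series is
asserted here); [AbsTopII] Cor. 3.3 (i) pp. 67–68 [cite: MochizukiAbsTopII2013, Cor 3.3 (i) p.67].

PROOF-ONLY knit (cell abc-iut, seat abc-iut-L5-t1 gen 11; HUB census `plan/L5/SUBDAG-IUTchI-Cor12.md`), ONE theorem, all by name:
abc-iut-f-090's `InitialThetaData.pe_characteristicNatureOfCoverings_of_originLaws_modLFields` (p495747; ROWS #6 R23: the record
`ModLCuspLaws` SPLIT — (L0) from (A), (L1) from (c), the four `Δ_ε`-sentences (L2a)(L2c)(L3)(L4) displayed), fed with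
* the two ORIGIN RECORDS `O : D.geom.pe.GeomOrigin`, `O′ : D′.geom.pe.GeomOrigin` (this seat's R6, p495678: (A) free profinite
  `Δ_X`, (c′) commutator cusp, (e) torsion-generated `Δ_C` — GAP-LEDGER G-L5t1g11-1, -2, -3), and
* abc-iut-w6-d032's L4→L5 ADAPTER `PuncturedEllipticData.hext_of_cor_3_3_i` / `hextC_of_cor_3_3_i` (p494401; ROWS #5 R7): the
  extension laws `hext`, `hextC` FROM [AbsTopII] Cor. 3.3 (i) as typed in L4 (`EllipticModel.Cor_3_3_i`, FACT-LIST F-0294, BY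
  NAME) at four model members `X, X′` (realised by `Π_{X̲→}, Π′_{X̲→}`) and `Y, Y′` (realised by `Π_{C̲→}, Π′_{C̲→}`) with their
  realisation data.
DISPLAYED TELESCOPE of `InitialThetaData.pe_characteristicNatureOfCoverings_of_geomOrigin_cor33i`:
DATA `C C′ A O O′` + the model data `𝒟 M bX bX′ bY bY′ X X′ Y Y′` with realisation data `ePi eC hcomp` ×4 and `hS hSY` ·
FACT-INSTANCE `h33 : M.Cor_3_3_i` (F-0294), `hfull hdgc` (the `𝒟`-hypotheses of Cor. 3.3), `hmaxX hmaxX′ hmaxY hmaxY′`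
([AbsAnab] Lem. 1.1.4 (i) shape, F-0005) · DATUM-INTERNAL `hX hX′ hY hY′ : IsCor33Member` · FACT `hA hA′` (F-0206) · GAP `h0 h0′`
(G-L5d4g6-1) · LAW = EXACTLY the eight printed `Δ_ε`-level sentences `hL2a hL2c hL3 hL4` ×2 ([IUTchI] p. 37 l. 34 – p. 38 l. 24;
(L2a) «`I_ε′ ≅ ℤ/l` in `Δ_ε`», (L2c) «`0 → I_ε′ × I_ε″ → Δ_ε`», (L3) «`ι` acts by `−1` on `Δ_E ⊗ ℤ/l`», (L4) «`G_k` trivial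
on `Δ_ε` [from (∗) via the Weil pairing]») — versus the certificate conjunct of record `layer5_held_cor12_v6` (14 LAW incl. the
vacuous `htf`): `hrank′ hΔ hΔ′ htf huniq′ hIH′ hext hextC hL L′` are GONE as laws (theorems of the origin records / F-0294 / split).

HONEST FRAMING: a by-name composition; the origin records and the model data are assumption-shaped DATA asserted for no instance;
typed ≠ discharged for F-0294/F-0005/F-0206 (FACT policy); the eight `Δ_ε`-sentences remain LAWS pending the lead's ruling (α)
(«COR12-MODL-HOMOLOGY-DATUM»); nothing here bears on [IUTchIII] Cor. 3.12 or asserts that abc is proved or refuted.  No `def`,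
no instance, no new `Prop` fact.
-/

noncomputable section

open CategoryTheory Topology

namespace Literature.IUT.HodgeTheaters.InitialThetaData

open scoped Pointwise
open Literature.AnabelianGeometry.AbsoluteAnabelian
open Literature.AnabelianGeometry.AbsoluteAnabelian.FundamentalExtension (CuspidalAlgorithm)
open Literature.AnabelianGeometry.AbsoluteAnabelian.AbsTopI (ConstructionDataClass)
open Literature.AnabelianGeometry.AbsoluteAnabelian.AbsTopII (EllipticModel)

universe u u' ud

variable {F : Type u} {K : Type} {Fbar : Type} [Field F] [NumberField F] [Field K] [NumberField K]
  [Algebra F K] [Field Fbar] [Algebra F Fbar] [Algebra K Fbar]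
  {E : WeierstrassCurve F} [E.IsElliptic] {l : ℕ} {Pb : BadPlacePredicates K}
  (D : InitialThetaData F K Fbar E l Pb)
  {F' : Type u'} {K' : Type} [Field F'] [NumberField F'] [Field K'] [NumberField K'] [Algebra F' K']
  {Fbar' : Type} [Field Fbar'] [Algebra F' Fbar'] [Algebra K' Fbar']
  {E' : WeierstrassCurve F'} [E'.IsElliptic] {l' : ℕ} {Pb' : BadPlacePredicates K'}
  (D' : InitialThetaData F' K' Fbar' E' l' Pb')

/-- **[IUTchI] Cor. 1.2 between the `K`-level data of two initial Θ-data — GRAND KNIT**: f-090's `…_of_originLaws_modLFields`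
(p495747) over the ORIGIN RECORDS `O O′` (p495678) with `hext`/`hextC` supplied by w6-d032's `hext_of_cor_3_3_i`/`hextC_of_cor_3_3_i`
(p494401) from [AbsTopII] Cor. 3.3 (i) AS TYPED IN L4 (F-0294 by name) at model members realised by `Π_{X̲→}, Π′_{X̲→}, Π_{C̲→},
Π′_{C̲→}`.  LAW binders = the eight printed `Δ_ε`-sentences (L2a)(L2c)(L3)(L4) at the two data, nothing else; every other binder
is DATA / FACT-INSTANCE (F-0294, F-0005-shape, F-0206) / DATUM-INTERNAL / GAP (G-L5d4g6-1).
([IUTchI] Cor 1.2 p.39) [claim: Mochizuki2012, status: disputed] -/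
theorem pe_characteristicNatureOfCoverings_of_geomOrigin_cor33i
    (O : D.geom.pe.GeomOrigin) (O' : D'.geom.pe.GeomOrigin)
    (C : D.geom.pe.CuspGalois) (C' : D'.geom.pe.CuspGalois)
    -- [AbsTopII] Cor 3.3 (i) as typed in L4: a model, F-0294 by name, the 𝒟-hypotheses
    {𝒟 : ConstructionDataClass.{ud}} (M : EllipticModel 𝒟) (h33 : M.Cor_3_3_i) (hfull : 𝒟.IsChainFull)
    (hdgc : 𝒟.RelIsomDGC)
    -- members X, X′ realised by Π_{X̲→}, Π′_{X̲→} with k-cores Π_C, Π′_C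
    {bX bX' : 𝒟.Base} {X : (𝒟.datum bX).Obj} {X' : (𝒟.datum bX').Obj}
    (hX : M.IsCor33Member bX X) (hX' : M.IsCor33Member bX' X') (hS : (𝒟.datum bX').primes = (𝒟.datum bX).primes)
    (hmaxX : ((𝒟.datum bX).ext X).GeomIsMaxTFGNormalIn ⊤) (hmaxX' : ((𝒟.datum bX').ext X').GeomIsMaxTFGNormalIn ⊤)
    (ePi : ((𝒟.datum bX).ext X).arith ≃ₜ* D.geom.pe.piXarrow) (eC : (M.coreExt bX X).arith ≃ₜ* D.geom.pe.PiC)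
    (hcomp : ∀ x, eC ((M.toCore bX X).arith x) = (ePi x : D.geom.pe.PiC))
    (ePi' : ((𝒟.datum bX').ext X').arith ≃ₜ* D'.geom.pe.piXarrow) (eC' : (M.coreExt bX' X').arith ≃ₜ* D'.geom.pe.PiC)
    (hcomp' : ∀ x, eC' ((M.toCore bX' X').arith x) = (ePi' x : D'.geom.pe.PiC))
    -- members Y, Y′ realised by Π_{C̲→}, Π′_{C̲→} with k-cores Π_C, Π′_C
    {bY bY' : 𝒟.Base} {Y : (𝒟.datum bY).Obj} {Y' : (𝒟.datum bY').Obj}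
    (hY : M.IsCor33Member bY Y) (hY' : M.IsCor33Member bY' Y') (hSY : (𝒟.datum bY').primes = (𝒟.datum bY).primes)
    (hmaxY : ((𝒟.datum bY).ext Y).GeomIsMaxTFGNormalIn ⊤) (hmaxY' : ((𝒟.datum bY').ext Y').GeomIsMaxTFGNormalIn ⊤)
    (fPi : ((𝒟.datum bY).ext Y).arith ≃ₜ* D.geom.pe.piCarrow) (fC : (M.coreExt bY Y).arith ≃ₜ* D.geom.pe.PiC)
    (hcompY : ∀ x, fC ((M.toCore bY Y).arith x) = (fPi x : D.geom.pe.PiC))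
    (fPi' : ((𝒟.datum bY').ext Y').arith ≃ₜ* D'.geom.pe.piCarrow) (fC' : (M.coreExt bY' Y').arith ≃ₜ* D'.geom.pe.PiC)
    (hcompY' : ∀ x, fC' ((M.toCore bY' Y').arith x) = (fPi' x : D'.geom.pe.PiC))
    -- the eight printed Δ_ε-level sentences (L2a)(L2c)(L3)(L4) at the two data
    (hL2a : D.geom.pe.deltaEpsKer.relIndex (D.geom.pe.inertia D.geom.pe.ε1 ⊔ D.geom.pe.deltaEpsKer) = D.geom.pe.l)
    (hL2c : D.geom.pe.inertia D.geom.pe.ε1 ⊓ (D.geom.pe.inertia D.geom.pe.ε2 ⊔ D.geom.pe.deltaEpsKer) ≤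
      D.geom.pe.deltaEpsKer)
    (hL3 : ∀ c ∈ D.geom.pe.DeltaCbar, c ∉ D.geom.pe.DeltaXbar → ∀ v ∈ D.geom.pe.DeltaXbar,
      c * v * c⁻¹ * v ∈ D.geom.pe.inertia D.geom.pe.ε1 ⊔ D.geom.pe.inertia D.geom.pe.ε2 ⊔ D.geom.pe.deltaEpsKer)
    (hL4 : ∀ x : D.geom.pe.Cusp, ∀ g ∈ D.geom.pe.PiXbar, ∀ z ∈ D.geom.pe.inertia x,
      g * z * g⁻¹ * z⁻¹ ∈ D.geom.pe.modLKer)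
    (hL2a' : D'.geom.pe.deltaEpsKer.relIndex (D'.geom.pe.inertia D'.geom.pe.ε1 ⊔ D'.geom.pe.deltaEpsKer) =
      D'.geom.pe.l)
    (hL2c' : D'.geom.pe.inertia D'.geom.pe.ε1 ⊓ (D'.geom.pe.inertia D'.geom.pe.ε2 ⊔ D'.geom.pe.deltaEpsKer) ≤
      D'.geom.pe.deltaEpsKer)
    (hL3' : ∀ c ∈ D'.geom.pe.DeltaCbar, c ∉ D'.geom.pe.DeltaXbar → ∀ v ∈ D'.geom.pe.DeltaXbar,
      c * v * c⁻¹ * v ∈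
        D'.geom.pe.inertia D'.geom.pe.ε1 ⊔ D'.geom.pe.inertia D'.geom.pe.ε2 ⊔ D'.geom.pe.deltaEpsKer)
    (hL4' : ∀ x : D'.geom.pe.Cusp, ∀ g ∈ D'.geom.pe.PiXbar, ∀ z ∈ D'.geom.pe.inertia x,
      g * z * g⁻¹ * z⁻¹ ∈ D'.geom.pe.modLKer)
    -- ramification of ε⁰ (GAP G-L5d4g6-1) and [AbsTopI] Lem 4.5 (v) (F-0206)
    (h0 : ¬ D.geom.pe.inertia D.geom.pe.ε0 ≤ D.geom.pe.piXarrow)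
    (h0' : ¬ D'.geom.pe.inertia D'.geom.pe.ε0 ≤ D'.geom.pe.piXarrow)
    (A : CuspidalAlgorithm.{0}) (hA : A.RecoversCusps D.geom.pe.extXbar C.cuspidalDataXbar)
    (hA' : A.RecoversCusps D'.geom.pe.extXbar C'.cuspidalDataXbar) :
    D.geom.pe.CharacteristicNatureOfCoverings D'.geom.pe :=
  D.pe_characteristicNatureOfCoverings_of_originLaws_modLFields D' C C' O.isFreeProOn O'.isFreeProOn
    O.inertia_eq_conj_commutator O'.inertia_eq_conj_commutator O'.deltaC_le_closure_torsion
    hL2a hL2c hL3 hL4 hL2a' hL2c' hL3' hL4' h0 h0'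
    (PuncturedEllipticData.hext_of_cor_3_3_i M h33 hfull hdgc hX hX' hS hmaxX hmaxX' ePi eC hcomp ePi' eC' hcomp')
    (PuncturedEllipticData.hextC_of_cor_3_3_i M h33 hfull hdgc hY hY' hSY hmaxY hmaxY' fPi fC hcompY fPi' fC' hcompY')
    A hA hA'

end Literature.IUT.HodgeTheaters.InitialThetaData
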